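import Summits.AtomisticToContinuum.BoseEinsteinCondensation.Theorems.BECSwapNoCatastropheTorusHalfSwapOverlapUpperFrameHardCorePointwise
import Summits.AtomisticToContinuum.BoseEinsteinCondensation.Theorems.BECSwapNoCatastropheTorusHalfSwapOverlapTwoCopyIMS
import HarnessLib

/-!
# Crux `TorusHalfSwapOverlap` (stmt-AtomisticToContinuum-14393), line `birth`, stub `stub_upperFrameHardCore` (S7),
# part C: assembly — the hard-core upper frame

Route `BECSwapNoCatastrophe` (sub-problem `BoseEinsteinCondensation`), lead c6 (2026-08-17). Last of four files: THE
HARD-CORE UPPER FRAME `inf_{Adm0} E2(½) ≤ 2 E₀^per(n+1, L) + C n L⁻³` for `L ≥ L₀`, `n ≤ c L³` — the half-swap defect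
costs `O(1)` uniformly in `n` for a hard core of radius `a` (`v = ⊤` on `[0, a]`, finite range `R₀`; `R = max R₀ a`,
`b = R + 2a`, `L₀ = 2b + 1`).

Mechanism (no eigen-equation): for a `δ`-near-minimiser `Ψ` and its translate, `Θ_t = Ψ(X) Ψ(Y - t𝟙)` is absolutely
admissible with `E2(0)(Θ_t) = 2 periodicEnergy v Ψ` (part S6b's two-state product API); with the smooth periodic CROSS
cut-off `φ(X, Y) = ∏ⱼ f(x₀ - yⱼ₊₁) ∏ⱼ f(y₀ - xⱼ₊₁)` (`f` the periodic factor of `f₀(y) = θ((|y| - R)/a)`) and the quadratic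
partition `J₁ = sin(πφ/2)`, `J₂ = cos(πφ/2)`, the two-copy IMS formula with the bosonic floor (S7i, hypothesis) gives
`E2(0)(Θ_t J₁) + 2E₀ ‖Θ_t J₂‖² ≤ 2 E(Ψ) + ∫ |Θ_t|² (|∇J₁|² + |∇J₂|²)`; the IMS error and the mass deficit `‖Θ_t J₂‖²` are
both `≤ ∫ W |Θ_t|²` pointwise (part C1: gradient identity, pointwise gradient bound with the packing count on the
hard-core support — S7a, hypothesis — and Jordan), whose translation average is `≤ n K`, `K = 2(c₁ ∫|∇f₀|² + ∫(1 - f₀²)) < ∞`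
(part B), so ONE translate `t` has `∫ W |Θ_t|² ≤ n K L⁻³ ≤ ½` (first moment, `n ≤ c L³`); the cross interaction vanishes on
`Θ_t J₁` (part C1); cancelling the finite floor `2E₀ ‖Θ_t J₂‖²`, normalising `Θ_t J₁` (mass `≥ ½`) and letting `δ → 0`
gives the claim with `C = 2 K.toReal`, `c = 1/(2 K.toReal + 1)` (`main_estimate`, `stub_upperFrameHardCore`). All in `ℝ≥0∞`.
[folklore]
-/

noncomputable section

open MeasureTheory Filter
open scoped ENNReal NNReal BigOperators ComplexConjugate

namespace Summit.AtomisticToContinuum.BoseEinsteinCondensation.Cruxes.TorusHalfSwapOverlap.Birth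

open Literature.MathematicalPhysics.QuantumManyBody.BoseGas

/-! ### Helper lemmas (inside `namespace UpperFrameHardCore … end UpperFrameHardCore`) -/

namespace UpperFrameHardCore

open Literature.Analysis.FunctionSpaces
open UpperFrameHardCoreCutoff UpperFrameHardCoreSupport UpperFrameHardCorePointwise
open Summit.AtomisticToContinuum.BoseEinsteinCondensation.TwoCopyTorus
  (kinetic2 cell2 E2zero E2half E2half_eq Adm0 IsPeriodic2)

/-! #### The estimate for a near-minimiser -/

/-- **The hard-core upper frame for a near-minimiser.** For a hard core of radius `a` with `v = 0` beyond
`R ≥ 0` there is a constant `K < ∞` (depending on `a`, `R` only) such that for all `n`, all `L > 2(R + 2a)`, every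
periodic trial state `Ψ` with `periodicEnergy v Ψ ≤ E₀ + δ` (`E₀ = E₀^per(n+1, L) < ∞`) and `n K L⁻³ ≤ ½`:
`inf_{Adm0} E2(½) ≤ 2 E₀ + 4δ + 2 n K L⁻³`. Proof: two-copy IMS (`hIMS`) on `Θ_t = Ψ ⊗ Ψ(· - t𝟙)` with the
quadratic partition `sin(πφ/2), cos(πφ/2)` of the cross cut-off; the IMS error and the mass deficit are bounded by
`∫ W |Θ_t|²`, whose translation average is `≤ n K` (`K = 2(c₁ ∫|∇f₀|² + ∫(1 - f₀²))`), so some translate `t` has both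
`≤ n K L⁻³ ≤ ½` (first moment); the cross interaction vanishes on `Θ_t J₁`; cancel the floor `2 E₀ ‖Θ_t J₂‖²` and
normalise `Θ_t J₁` (mass `≥ ½`). [folklore] -/
theorem main_estimate
    (hPk : ∀ (a R : ℝ), 0 < a → 0 ≤ R → ∀ (s : Finset Space) (p : Space),
      (∀ x ∈ s, ∀ y ∈ s, x ≠ y → a ≤ ‖x - y‖) → (∀ x ∈ s, ‖x - p‖ ≤ R) → (s.card : ℝ) ≤ (1 + 2 * R / a) ^ 3)
    (hIMS : ∀ v : ℝ → ℝ≥0∞, IsRepulsiveFiniteRange v → ∀ (n : ℕ) (L : ℝ) (Θ : Config (n + 1) × Config (n + 1) → ℂ)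
      (J₁ J₂ : Config (n + 1) × Config (n + 1) → ℝ),
      ContDiff ℝ 1 Θ → TwoCopyTorus.IsPeriodic2 n L Θ → ContDiff ℝ 1 J₁ → ContDiff ℝ 1 J₂ →
      TwoCopyTorus.IsPeriodic2 n L (fun Z => (J₁ Z : ℂ)) → TwoCopyTorus.IsPeriodic2 n L (fun Z => (J₂ Z : ℂ)) →
      (∀ Z, J₁ Z ^ 2 + J₂ Z ^ 2 = 1) →
      TwoCopyTorus.E2zero v n L (fun Z => Θ Z * (J₁ Z : ℂ)) +
          2 * periodicGroundStateEnergy v (n + 1) L *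
            ∫⁻ Z in TwoCopyTorus.cell2 n L, (‖Θ Z * (J₂ Z : ℂ)‖₊ : ℝ≥0∞) ^ 2 ≤
        TwoCopyTorus.E2zero v n L Θ +
          ∫⁻ Z in TwoCopyTorus.cell2 n L, (‖Θ Z‖₊ : ℝ≥0∞) ^ 2 *
            (TwoCopyTorus.kinetic2 n (fun W => (J₁ W : ℂ)) Z + TwoCopyTorus.kinetic2 n (fun W => (J₂ W : ℂ)) Z))
    {v : ℝ → ℝ≥0∞} (hv : IsRepulsiveFiniteRange v) {a R : ℝ} (ha : 0 < a) (hR : 0 ≤ R)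
    (hcore : ∀ r : ℝ, 0 ≤ r → r ≤ a → v r = ⊤) (hvR : ∀ r, R < r → v r = 0) :
    ∃ K : ℝ≥0∞, K ≠ ⊤ ∧ ∀ (n : ℕ) (L : ℝ), 2 * (R + 2 * a) < L →
      ∀ (Ψ : PeriodicTrialState (n + 1) L) (δ : ℝ≥0∞),
        periodicEnergy v Ψ ≤ periodicGroundStateEnergy v (n + 1) L + δ →
        periodicGroundStateEnergy v (n + 1) L ≠ ⊤ →
        (n : ℝ≥0∞) * K * (ENNReal.ofReal (L ^ 3))⁻¹ ≤ 2⁻¹ →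
        (⨅ (Θ : Config (n + 1) × Config (n + 1) → ℂ) (_ : Adm0 n L Θ), E2half v n L Θ) ≤
          2 * periodicGroundStateEnergy v (n + 1) L + (4 * δ + 2 * ((n : ℝ≥0∞) * K * (ENNReal.ofReal (L ^ 3))⁻¹)) := by
  -- constants depending on `a`, `R` only
  set b : ℝ := R + 2 * a with hb
  have hb0 : 0 ≤ b := by positivity
  set f₀ : Space → ℝ := fun y => Torus.smoothCutProfile ((‖y‖ - R) / a) with hf₀
  have hφ₀ : IsPairProfile b f₀ := isPairProfile_cut ha hR
  set c₁ : ℝ≥0∞ := ENNReal.ofReal ((Real.pi / 2) ^ 2) * ENNReal.ofReal ((1 + 2 * b / a) ^ 3 + 1) with hc₁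
  set K : ℝ≥0∞ := 2 * (c₁ * (∫⁻ x, gradSq f₀ x) + profileDefect f₀) with hK
  have hKtop : K ≠ ⊤ :=
    ENNReal.mul_ne_top ENNReal.ofNat_ne_top (ENNReal.add_ne_top.2
      ⟨ENNReal.mul_ne_top (ENNReal.mul_ne_top ENNReal.ofReal_ne_top ENNReal.ofReal_ne_top)
        hφ₀.lintegral_gradSq_lt_top.ne, hφ₀.profileDefect_lt_top.ne⟩)
  refine ⟨K, hKtop, ?_⟩
  intro n L hbL Ψ δ hδ hE₀ hsmall
  set E₀ := periodicGroundStateEnergy v (n + 1) L with hE₀def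
  set M : ℝ≥0∞ := (n : ℝ≥0∞) * K * (ENNReal.ofReal (L ^ 3))⁻¹ with hM
  have hL : 0 < L := by linarith
  -- trivial if `δ = ⊤`
  rcases eq_or_ne δ ⊤ with rfl | hδtop
  · rw [ENNReal.mul_top four_ne_zero, top_add, add_top]
    exact le_top
  have hEΨ : periodicEnergy v Ψ ≠ ⊤ := ne_top_of_le_ne_top (ENNReal.add_ne_top.2 ⟨hE₀, hδtop⟩) hδ
  have hsupp : ∀ X : Config (n + 1), Ψ.ψ X ≠ 0 → ∀ i j : Fin (n + 1), i ≠ j → ∀ m : Fin 3 → ℤ,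
      a ≤ ‖X i - X j - latticeVec L m‖ :=
    fun X hX i j hij m => le_norm_sub_sub_latticeVec hcore hL Ψ hEΨ hX hij m
  -- the periodic factor, the kernel and the weight
  set f : Space → ℝ := pairFactor L f₀ with hf
  have hfC : ContDiff ℝ 1 f := hφ₀.contDiff_pairFactor hL hbL
  have hf0 : ∀ y, 0 ≤ f y := fun y => hφ₀.pairFactor_nonneg y
  have hf1 : ∀ y, f y ≤ 1 := fun y => hφ₀.pairFactor_le_one y
  have hfper : ∀ (y : Space) (m : Fin 3 → ℤ), f (y + latticeVec L m) = f y :=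
    fun y m => pairFactor_add_latticeVec hL.ne' f₀ y m
  set G : Space → ℝ≥0∞ := fun y => c₁ * gradSq f y + ENNReal.ofReal (1 - f y ^ 2) with hG
  set W : Config (n + 1) × Config (n + 1) → ℝ≥0∞ :=
    fun Z => ∑ j : Fin n, (G (Z.1 0 - Z.2 j.succ) + G (Z.2 0 - Z.1 j.succ)) with hW
  have hGm : Measurable G := measurable_kernel hφ₀ hL hbL c₁
  have hGe : ∀ y, G (-y) = G y := kernel_neg hφ₀ hL hbL c₁
  have hGper : ∀ (y : Space) (m : Fin 3 → ℤ), G (y + latticeVec L m) = G y := kernel_add_latticeVec hφ₀ hL hbL c₁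
  have hWm : Measurable W := measurable_crossKernel hGm
  -- averaging over translations and the first moment: a good translate `t`
  have havg : ∫⁻ t in cell L, ∫⁻ Z in cell2 n L,
      W Z * ((‖Ψ.ψ Z.1 * Ψ.ψ (Z.2 - fun _ => t)‖₊ : ℝ≥0∞)) ^ 2 ≤ (n : ℝ≥0∞) * K :=
    lintegral_cell_translate_le hL Ψ hWm (fun X Y i k => crossKernel_add_single hGper X Y i k)
      fun Z => lintegral_cell_crossKernel_shift_le hGm hGe (lintegral_cell_kernel_le hφ₀ hL hbL c₁) Z
  have hV : volume (cell L) = ENNReal.ofReal (L ^ 3) := by rw [volume_cell, ENNReal.ofReal_pow hL.le]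
  have hV0 : volume (cell L) ≠ 0 := by rw [hV]; exact (ENNReal.ofReal_pos.2 (by positivity)).ne'
  have hVt : volume (cell L) ≠ ⊤ := by rw [hV]; exact ENNReal.ofReal_ne_top
  obtain ⟨t, -, ht⟩ := exists_le_setLAverage hV0 hVt (measurable_lintegral_translate Ψ hWm).aemeasurable
  have hFt : ∫⁻ Z in cell2 n L, W Z * ((‖Ψ.ψ Z.1 * Ψ.ψ (Z.2 - fun _ => t)‖₊ : ℝ≥0∞)) ^ 2 ≤ M := by
    refine ht.trans ?_
    rw [setLAverage_eq, hV, hM, ← div_eq_mul_inv]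
    exact ENNReal.div_le_div_right havg _
  -- the translated product state `Θ = Ψ ⊗ Ψ(· - t𝟙)`
  obtain ⟨Φ, hΦ⟩ := Ψ.exists_translate t
  set Θ : Config (n + 1) × Config (n + 1) → ℂ := fun Z => Ψ.ψ Z.1 * Φ.ψ Z.2 with hΘ
  have hΘ' : ∀ Z, Θ Z = Ψ.ψ Z.1 * Ψ.ψ (Z.2 - fun _ => t) := fun Z => by simp only [hΘ, hΦ]
  have hΘC : ContDiff ℝ 1 Θ := UpperFrameIntegrable.contDiff_prod₂ Ψ Φ
  have hΘper : IsPeriodic2 n L Θ := fun Z i k => UpperFrameIntegrable.periodic_prod₂ Ψ Φ Z i k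
  have hΘmass : ∫⁻ Z in cell2 n L, ((‖Θ Z‖₊ : ℝ≥0∞)) ^ 2 = 1 := by
    simp_rw [hΘ, TwoCopyTorus.cell2, ennnorm_mul_sq]
    exact UpperFrameIntegrable.lintegral_normSq_mul_normSq Ψ Φ
  have hΘzero : E2zero v n L Θ = 2 * periodicEnergy v Ψ := by
    have h := UpperFrameIntegrable.energy_prod₂_eq hv.1 Ψ Φ
    rw [periodicEnergy_translate v Ψ t hΦ, ← two_mul] at h
    exact h
  -- the cross cut-off and the quadratic partition
  set φ : Config (n + 1) × Config (n + 1) → ℝ :=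
    fun Z => (∏ j : Fin n, f (Z.1 0 - Z.2 j.succ)) * ∏ j : Fin n, f (Z.2 0 - Z.1 j.succ) with hφ
  set J₁ : Config (n + 1) × Config (n + 1) → ℝ := fun Z => Real.sin (Real.pi / 2 * φ Z) with hJ₁
  set J₂ : Config (n + 1) × Config (n + 1) → ℝ := fun Z => Real.cos (Real.pi / 2 * φ Z) with hJ₂
  have hφC : ContDiff ℝ 1 φ := contDiff_crossCutoff hfC
  have hφper : ∀ (Z : Config (n + 1) × Config (n + 1)) (i : Fin (n + 1)) (k : Fin 3),
      φ (Z.1 + Pi.single i (EuclideanSpace.single k L), Z.2) = φ Z ∧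
        φ (Z.1, Z.2 + Pi.single i (EuclideanSpace.single k L)) = φ Z :=
    fun Z i k => crossCutoff_periodic hfper Z i k
  have hJ₁per : IsPeriodic2 n L fun Z => (J₁ Z : ℂ) := fun Z i k => by
    constructor <;> simp only [hJ₁, (hφper Z i k).1, (hφper Z i k).2]
  have hJ₂per : IsPeriodic2 n L fun Z => (J₂ Z : ℂ) := fun Z i k => by
    constructor <;> simp only [hJ₂, (hφper Z i k).1, (hφper Z i k).2]
  have hJ : ∀ Z, J₁ Z ^ 2 + J₂ Z ^ 2 = 1 := fun Z => Real.sin_sq_add_cos_sq _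
  have hims := hIMS v hv n L Θ J₁ J₂ hΘC hΘper (Real.contDiff_sin.comp (contDiff_const.mul hφC))
    (Real.contDiff_cos.comp (contDiff_const.mul hφC)) hJ₁per hJ₂per hJ
  -- masses
  set m₁ : ℝ≥0∞ := ∫⁻ Z in cell2 n L, ((‖Θ Z * (J₁ Z : ℂ)‖₊ : ℝ≥0∞)) ^ 2 with hm₁
  set m₂ : ℝ≥0∞ := ∫⁻ Z in cell2 n L, ((‖Θ Z * (J₂ Z : ℂ)‖₊ : ℝ≥0∞)) ^ 2 with hm₂
  have hΘ₁C : ContDiff ℝ 1 fun Z => Θ Z * (J₁ Z : ℂ) :=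
    hΘC.mul (Complex.ofRealCLM.contDiff.comp (Real.contDiff_sin.comp (contDiff_const.mul hφC)))
  have hm12 : m₁ + m₂ = 1 := by
    rw [hm₁, hm₂, ← lintegral_add_left (hΘ₁C.continuous.measurable.nnnorm.coe_nnreal_ennreal.pow_const _)]
    simp_rw [TwoCopyIMS.ennnorm_sq_mul_add _ (hJ _)]
    exact hΘmass
  -- IMS error and mass deficit are bounded by `M ≤ ½`
  have hNum : ∫⁻ Z in cell2 n L, ((‖Θ Z‖₊ : ℝ≥0∞)) ^ 2 *
      (kinetic2 n (fun W => (J₁ W : ℂ)) Z + kinetic2 n (fun W => (J₂ W : ℂ)) Z) ≤ M := by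
    refine (lintegral_mono fun Z => ?_).trans hFt
    rw [hΘ' Z]
    exact normSq_mul_kinetic2_le hPk ha hb0 hφ₀ hL hbL Ψ hsupp (Real.pi / 2) t Z
  have hm₂M : m₂ ≤ M := by
    refine (lintegral_mono fun Z => ?_).trans hFt
    rw [hΘ' Z]
    exact normSq_mul_cos_le hf0 hf1 (fun y => c₁ * gradSq f y) _ Z
  have hm₂half : m₂ ≤ 2⁻¹ := hm₂M.trans hsmall
  have hm₁ : 2⁻¹ ≤ m₁ := by
    refine ENNReal.le_of_add_le_add_right (by simp : (2 : ℝ≥0∞)⁻¹ ≠ ⊤) ?_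
    rw [ENNReal.inv_two_add_inv_two, ← hm12]
    exact add_le_add le_rfl hm₂half
  have hm₁0 : m₁ ≠ 0 := (lt_of_lt_of_le (by simp) hm₁).ne'
  have hm₁le : m₁ ≤ 1 := le_of_le_of_eq le_self_add hm12
  have hm₂le : m₂ ≤ 1 := le_of_le_of_eq le_add_self hm12
  have hm₁t : m₁ ≠ ⊤ := ne_top_of_le_ne_top ENNReal.one_ne_top hm₁le
  -- the chain of inequalities
  have hcross : E2half v n L (fun Z => Θ Z * (J₁ Z : ℂ)) ≤ E2zero v n L (fun Z => Θ Z * (J₁ Z : ℂ)) :=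
    E2half_le_E2zero_of_cut hv.1 ha hR hvR hL hbL hΘC.continuous (Real.pi / 2)
  have key : E2zero v n L (fun Z => Θ Z * (J₁ Z : ℂ)) ≤ 2 * E₀ * m₁ + (2 * δ + M) := by
    have hfin : 2 * E₀ * m₂ ≠ ⊤ :=
      ENNReal.mul_ne_top (ENNReal.mul_ne_top ENNReal.ofNat_ne_top hE₀) (ne_top_of_le_ne_top ENNReal.one_ne_top hm₂le)
    refine (ENNReal.add_le_add_iff_right hfin).1 (hims.trans ?_)
    calc E2zero v n L Θ + ∫⁻ Z in cell2 n L, ((‖Θ Z‖₊ : ℝ≥0∞)) ^ 2 *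
          (kinetic2 n (fun W => (J₁ W : ℂ)) Z + kinetic2 n (fun W => (J₂ W : ℂ)) Z)
        ≤ 2 * (E₀ + δ) + M := by
          rw [hΘzero]
          exact add_le_add (mul_le_mul_right hδ 2) hNum
      _ = 2 * E₀ * (m₁ + m₂) + (2 * δ + M) := by rw [hm12]; ring
      _ = 2 * E₀ * m₁ + (2 * δ + M) + 2 * E₀ * m₂ := by ring
  have hinv : m₁⁻¹ ≤ 2 := by
    calc m₁⁻¹ ≤ (2⁻¹ : ℝ≥0∞)⁻¹ := ENNReal.inv_le_inv.2 hm₁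
      _ = 2 := inv_inv 2
  calc (⨅ (Θ : Config (n + 1) × Config (n + 1) → ℂ) (_ : Adm0 n L Θ), E2half v n L Θ)
      ≤ m₁⁻¹ * E2half v n L (fun Z => Θ Z * (J₁ Z : ℂ)) := by
        refine iInf_le_inv_mul v hΘ₁C (fun Z i k => ?_) hm₁0 hm₁t
        obtain ⟨h1, h2⟩ := hΘper Z i k
        obtain ⟨h3, h4⟩ := hJ₁per Z i k
        dsimp only at h3 h4 ⊢
        rw [h1, h2, h3, h4]
        exact ⟨rfl, rfl⟩
    _ ≤ m₁⁻¹ * (2 * E₀ * m₁ + (2 * δ + M)) := mul_le_mul_right (hcross.trans key) _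
    _ = 2 * E₀ + m₁⁻¹ * (2 * δ + M) := by
        rw [mul_add, ← mul_assoc, mul_comm m₁⁻¹ (2 * E₀), mul_assoc (2 * E₀), ENNReal.inv_mul_cancel hm₁0 hm₁t,
          mul_one]
    _ ≤ 2 * E₀ + 2 * (2 * δ + M) := add_le_add le_rfl (mul_le_mul_left hinv _)
    _ = 2 * E₀ + (4 * δ + 2 * M) := by ring

end UpperFrameHardCore

/-! ### The registered stub -/

/-- S7 — **the hard-core upper frame: the half-swap defect costs `O(1)` uniformly in `n`**. For every repulsive
finite-range `v` with a hard core of radius `a > 0` (`v = ⊤` on `[0, a]`) there are `C`, `L₀`, `c > 0` with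
`inf_{Adm0} E2(½) ≤ 2 E₀^per(n+1, L) + C n L⁻³` whenever `L ≥ L₀` and `n ≤ c L³`, from the volume packing bound
(S7a, hypothesis) and the two-copy IMS formula with the bosonic floor (S7i, hypothesis): smooth periodic cross
cut-off, translation averaging, first moment, packing on the hard-core support, `δ → 0`
(`stub_upperFrameHardCore`, registered signature). [folklore] -/
theorem stub_upperFrameHardCore :
    (∀ (a R : ℝ), 0 < a → 0 ≤ R → ∀ (s : Finset Space) (p : Space),
        (∀ x ∈ s, ∀ y ∈ s, x ≠ y → a ≤ ‖x - y‖) → (∀ x ∈ s, ‖x - p‖ ≤ R) →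
        (s.card : ℝ) ≤ (1 + 2 * R / a) ^ 3) →
    (∀ v : ℝ → ℝ≥0∞, IsRepulsiveFiniteRange v → ∀ (n : ℕ) (L : ℝ) (Θ : Config (n + 1) × Config (n + 1) → ℂ)
        (J₁ J₂ : Config (n + 1) × Config (n + 1) → ℝ),
        ContDiff ℝ 1 Θ → TwoCopyTorus.IsPeriodic2 n L Θ → ContDiff ℝ 1 J₁ → ContDiff ℝ 1 J₂ →
        TwoCopyTorus.IsPeriodic2 n L (fun Z => (J₁ Z : ℂ)) → TwoCopyTorus.IsPeriodic2 n L (fun Z => (J₂ Z : ℂ)) →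
        (∀ Z, J₁ Z ^ 2 + J₂ Z ^ 2 = 1) →
        TwoCopyTorus.E2zero v n L (fun Z => Θ Z * (J₁ Z : ℂ)) +
            2 * periodicGroundStateEnergy v (n + 1) L *
              ∫⁻ Z in TwoCopyTorus.cell2 n L, (‖Θ Z * (J₂ Z : ℂ)‖₊ : ℝ≥0∞) ^ 2 ≤
          TwoCopyTorus.E2zero v n L Θ +
            ∫⁻ Z in TwoCopyTorus.cell2 n L, (‖Θ Z‖₊ : ℝ≥0∞) ^ 2 *
              (TwoCopyTorus.kinetic2 n (fun W => (J₁ W : ℂ)) Z + TwoCopyTorus.kinetic2 n (fun W => (J₂ W : ℂ)) Z)) →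
    ∀ v : ℝ → ℝ≥0∞, IsRepulsiveFiniteRange v → ∀ a : ℝ, 0 < a → (∀ r : ℝ, 0 ≤ r → r ≤ a → v r = ⊤) →
      ∃ C L₀ c : ℝ, 0 < c ∧ ∀ (n : ℕ) (L : ℝ), L₀ ≤ L → (n : ℝ) ≤ c * L ^ 3 →
        (⨅ (Θ : Config (n + 1) × Config (n + 1) → ℂ) (_ : TwoCopyTorus.Adm0 n L Θ), TwoCopyTorus.E2half v n L Θ) ≤
          2 * periodicGroundStateEnergy v (n + 1) L + ENNReal.ofReal C * (n : ℝ≥0∞) * (ENNReal.ofReal (L ^ 3))⁻¹ := by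
  intro hPk hIMS v hv a ha hcore
  obtain ⟨R₀, hR₀⟩ := hv.2
  have hR : 0 ≤ max R₀ a := ha.le.trans (le_max_right _ _)
  have hvR : ∀ r, max R₀ a < r → v r = 0 := fun r hr => hR₀ r ((le_max_left _ _).trans_lt hr)
  obtain ⟨K, hKtop, hmain⟩ := UpperFrameHardCore.main_estimate hPk hIMS hv ha hR hcore hvR
  have hK0 : 0 ≤ K.toReal := ENNReal.toReal_nonneg
  refine ⟨2 * K.toReal, 2 * (max R₀ a + 2 * a) + 1, 1 / (2 * K.toReal + 1), by positivity, ?_⟩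
  intro n L hL₀ hn
  have hbL : 2 * (max R₀ a + 2 * a) < L := by linarith
  have hL : 0 < L := by nlinarith [hR, ha]
  have hL3 : 0 < L ^ 3 := by positivity
  -- trivial if `E₀ = ⊤`
  rcases eq_or_ne (periodicGroundStateEnergy v (n + 1) L) ⊤ with hE | hE
  · rw [hE, ENNReal.mul_top two_ne_zero, top_add]
    exact le_top
  have hKofReal : ENNReal.ofReal K.toReal = K := ENNReal.ofReal_toReal hKtop
  -- `n ≤ c L³` makes `n K L⁻³ ≤ ½`
  have hsmall : (n : ℝ≥0∞) * K * (ENNReal.ofReal (L ^ 3))⁻¹ ≤ 2⁻¹ := by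
    have hV0 : ENNReal.ofReal (L ^ 3) ≠ 0 := (ENNReal.ofReal_pos.2 hL3).ne'
    have h1 : (n : ℝ≥0∞) ≤ ENNReal.ofReal (L ^ 3) * ENNReal.ofReal (1 / (2 * K.toReal + 1)) := by
      rw [← ENNReal.ofReal_mul hL3.le, ← ENNReal.ofReal_natCast]
      exact ENNReal.ofReal_le_ofReal (by rw [mul_comm]; exact hn)
    have h2 : 1 / (2 * K.toReal + 1) * K.toReal ≤ 2⁻¹ := by
      rw [div_mul_eq_mul_div, one_mul, div_le_iff₀ (by positivity)]
      linarith
    calc (n : ℝ≥0∞) * K * (ENNReal.ofReal (L ^ 3))⁻¹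
        ≤ ENNReal.ofReal (L ^ 3) * ENNReal.ofReal (1 / (2 * K.toReal + 1)) * K * (ENNReal.ofReal (L ^ 3))⁻¹ := by
          gcongr
      _ = ENNReal.ofReal (1 / (2 * K.toReal + 1)) * K := by
          rw [mul_comm (ENNReal.ofReal (L ^ 3)), mul_assoc, mul_assoc, mul_comm K, ← mul_assoc (ENNReal.ofReal (L ^ 3)),
            ENNReal.mul_inv_cancel hV0 ENNReal.ofReal_ne_top, one_mul]
      _ ≤ 2⁻¹ := by
          have h2inv : ENNReal.ofReal (2⁻¹ : ℝ) = 2⁻¹ := by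
            rw [ENNReal.ofReal_inv_of_pos two_pos, ENNReal.ofReal_ofNat]
          have h3 : ENNReal.ofReal (1 / (2 * K.toReal + 1)) * ENNReal.ofReal K.toReal ≤ 2⁻¹ := by
            rw [← h2inv, ← ENNReal.ofReal_mul (by positivity)]
            exact ENNReal.ofReal_le_ofReal h2
          rwa [hKofReal] at h3
  have h2M : 2 * ((n : ℝ≥0∞) * K * (ENNReal.ofReal (L ^ 3))⁻¹) =
      ENNReal.ofReal (2 * K.toReal) * (n : ℝ≥0∞) * (ENNReal.ofReal (L ^ 3))⁻¹ := by
    rw [ENNReal.ofReal_mul zero_le_two, ENNReal.ofReal_ofNat, hKofReal]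
    ring
  -- `δ → 0`
  refine ENNReal.le_of_forall_pos_le_add fun ε hε _ => ?_
  have hδ0 : (ε : ℝ≥0∞) / 4 ≠ 0 := (ENNReal.div_pos (by exact_mod_cast hε.ne') (by norm_num)).ne'
  obtain ⟨Ψ, hΨ⟩ : ∃ Ψ : PeriodicTrialState (n + 1) L,
      periodicEnergy v Ψ < periodicGroundStateEnergy v (n + 1) L + ε / 4 :=
    iInf_lt_iff.1 (ENNReal.lt_add_right hE hδ0)
  calc (⨅ (Θ : Config (n + 1) × Config (n + 1) → ℂ) (_ : TwoCopyTorus.Adm0 n L Θ), TwoCopyTorus.E2half v n L Θ)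
      ≤ 2 * periodicGroundStateEnergy v (n + 1) L +
          (4 * ((ε : ℝ≥0∞) / 4) + 2 * ((n : ℝ≥0∞) * K * (ENNReal.ofReal (L ^ 3))⁻¹)) :=
        hmain n L hbL Ψ _ hΨ.le hE hsmall
    _ = 2 * periodicGroundStateEnergy v (n + 1) L +
          ENNReal.ofReal (2 * K.toReal) * (n : ℝ≥0∞) * (ENNReal.ofReal (L ^ 3))⁻¹ + ε := by
        rw [ENNReal.mul_div_cancel four_ne_zero ENNReal.ofNat_ne_top, h2M]
        ring

end Summit.AtomisticToContinuum.BoseEinsteinCondensation.Cruxes.TorusHalfSwapOverlap.Birth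

end
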